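import Summits.HodgeConjecture.CorCM.PairFlipSexticTimesReflexOcticHodge
import Literature.NumberTheory.ComplexMultiplication.ComplexReflexFieldStabilizer
import HarnessLib

/-!
# The reflex-octic dichotomy from the IMAGE of the embedding: `ψ₀(K_F) = ℚ(tr_{Φ_T}(K_T))`

COR-CM (cell `pub-hodgecm2`, binder seat `b16` gen 45, count-neutral claim REFLEX-OCTIC-34, file F6); theorems only, no
definition, no named fact, no `sorry`.  Glue for `PairFlipSexticTimesReflexOcticHodge`: there the second CM field `K_{i₁}`
is tied to the reflex field of `(K_{i₀}, Φ_T)` through an embedding `ψ₀ : K_{i₁} → ℂ` whose FIXER in `Aut(ℂ)` is the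
STABILISER of `Φ_T`.  By Shimura's Prop. 28 (tree: `ComplexReflexFieldStabilizer`, `σΦ = Φ ⟺ σ|_{K*} = id` for the
complex reflex field `K* = traceField Φ = ℚ(tr_Φ(K))`) this is the same as asking that the IMAGE of `ψ₀` be `K*`:

* `smul_eq_iff_forall_smul_mem_iff_of_range_eq_traceField` — if `ψ₀(K') = traceField Φ` (as subsets of `ℂ`) then
  `σψ₀ = ψ₀ ⟺ σΦ = Φ` for every `σ ∈ Aut(ℂ)` (any CM type `Φ` of any number field `K`, any field `K'`);
* `isNondegenerateFamily_iff_of_range_eq_traceField` — the dichotomy of `PairFlipSexticTimesReflexOcticHodge` restated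
  with the hypothesis `Set.range ψ₀ = traceField (Φ i₀)`; `finrank_eq_eight_of_range_eq_traceField` — such a `K_{i₁}` is
  octic.

## References

* [Shimura1998] G. Shimura, *Abelian Varieties with Complex Multiplication and Modular Functions*, §8.3 Prop. 28.
* [Dodson1984] B. Dodson, *The structure of Galois groups of CM-fields*, Trans. AMS 283 (1984), §1, §3.3.2.
-/

noncomputable section

open NumberField Module
open scoped BigOperators Classical

namespace Summit.HodgeConjecture.CorCM

open Literature.NumberTheory.ComplexMultiplication
open Literature.AlgebraicGeometry.Motives (CMType)
open Literature.AlgebraicGeometry.Pohlmann1968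

/-- **`ψ₀(K') = K*` ⟹ `Fix(ψ₀) = Stab(Φ)` in `Aut(ℂ)`** (`K* = traceField Φ`, Shimura's Prop. 28 in the tree's
`Aut(ℂ)`-form). [cite: Shimura1998, §8.3 Prop. 28] -/
theorem smul_eq_iff_forall_smul_mem_iff_of_range_eq_traceField {K K' : Type} [Field K] [NumberField K] [Field K']
    (Φ : CMType K) (ψ₀ : K' →+* ℂ) (hr : Set.range ψ₀ = (traceField Φ : Set ℂ)) (σ : ℂ ≃+* ℂ) :
    σ • ψ₀ = ψ₀ ↔ ∀ x : K →+* ℂ, σ • x ∈ Φ.1 ↔ x ∈ Φ.1 := by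
  rw [forall_smul_mem_iff_iff_forall_apply_traceField_eq]
  constructor
  · intro h z hz
    have hz' : z ∈ Set.range ψ₀ := by rw [hr]; exact hz
    obtain ⟨w, rfl⟩ := hz'
    have h1 := congrArg (fun f : K' →+* ℂ => f w) h
    simpa only [ringEquiv_smul_apply] using h1
  · intro h
    refine RingHom.ext fun w => ?_
    have hw : ψ₀ w ∈ (traceField Φ : Set ℂ) := by rw [← hr]; exact ⟨w, rfl⟩
    rw [ringEquiv_smul_apply]
    exact h _ hw

variable {I : Type} {K : I → Type} [∀ i, Field (K i)] [∀ i, NumberField (K i)] [∀ i, IsCMField (K i)] [Fintype I]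

omit [Fintype I] in
/-- **A CM field embedded onto the complex reflex field of a type of a pair-flip sextic field is OCTIC.**
[cite: Dodson1984, §1 (Reflex Degree Theorem)] [cite: Shimura1998, §8.3 Prop. 28] -/
theorem finrank_eq_eight_of_range_eq_traceField {i₀ i₁ : I} (h6 : finrank ℚ (K i₀) = 6)
    (hflip : ∀ s : K i₀ →+* ℂ, ∃ σ : ℂ ≃+* ℂ, σ • s = (starRingAut : ℂ ≃+* ℂ) • s ∧
      ∀ t : K i₀ →+* ℂ, t ≠ s → t ≠ (starRingAut : ℂ ≃+* ℂ) • s → σ • t = t)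
    (Φ : ∀ i, CMType (K i)) {ψ₀ : K i₁ →+* ℂ} (hr : Set.range ψ₀ = (traceField (Φ i₀) : Set ℂ)) :
    finrank ℚ (K i₁) = 8 :=
  finrank_eq_eight_of_reflexOctic h6 hflip Φ (smul_eq_iff_forall_smul_mem_iff_of_range_eq_traceField (Φ i₀) ψ₀ hr)

/-- **The reflex-octic dichotomy with the hypothesis `ψ₀(K_{i₁}) = traceField (Φ i₀)`**: `(Φ_T, Ψ)` is a nondegenerate
family iff `Ψ` is nondegenerate and is neither Hamming ball (`ψ₀` with its three flip-neighbours all in `Ψ`, or all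
outside `Ψ`). [cite: Dodson1984, §3.3.2 and Prop. 5.2.2] [cite: Shimura1998, §8.3 Prop. 28]
[cite: Gordon1999HodgeAVSurvey, 7.5–7.7] -/
theorem isNondegenerateFamily_iff_of_range_eq_traceField {i₀ i₁ : I} (h01 : i₀ ≠ i₁) (hI : ∀ j, j = i₀ ∨ j = i₁)
    (h6 : finrank ℚ (K i₀) = 6)
    (hflip : ∀ s : K i₀ →+* ℂ, ∃ σ : ℂ ≃+* ℂ, σ • s = (starRingAut : ℂ ≃+* ℂ) • s ∧
      ∀ t : K i₀ →+* ℂ, t ≠ s → t ≠ (starRingAut : ℂ ≃+* ℂ) • s → σ • t = t)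
    (Φ : ∀ i, CMType (K i)) {ψ₀ : K i₁ →+* ℂ} (hr : Set.range ψ₀ = (traceField (Φ i₀) : Set ℂ)) :
    CMAlgebra.IsNondegenerateFamily Φ ↔ IsNondegenerate (Φ i₁) ∧
      ¬ (ψ₀ ∈ (Φ i₁).1 ∧ ∀ (x : K i₀ →+* ℂ) (σ : ℂ ≃+* ℂ), x ∈ (Φ i₀).1 →
        σ • x = (starRingAut : ℂ ≃+* ℂ) • x →
        (∀ t : K i₀ →+* ℂ, t ≠ x → t ≠ (starRingAut : ℂ ≃+* ℂ) • x → σ • t = t) → σ • ψ₀ ∈ (Φ i₁).1) ∧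
      ¬ (ψ₀ ∉ (Φ i₁).1 ∧ ∀ (x : K i₀ →+* ℂ) (σ : ℂ ≃+* ℂ), x ∈ (Φ i₀).1 →
        σ • x = (starRingAut : ℂ ≃+* ℂ) • x →
        (∀ t : K i₀ →+* ℂ, t ≠ x → t ≠ (starRingAut : ℂ ≃+* ℂ) • x → σ • t = t) → σ • ψ₀ ∉ (Φ i₁).1) :=
  isNondegenerateFamily_iff_of_reflexOctic h01 hI h6 hflip Φ
    (smul_eq_iff_forall_smul_mem_iff_of_range_eq_traceField (Φ i₀) ψ₀ hr)

end Summit.HodgeConjecture.CorCM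

end
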